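import Summits.QuantumFields.BalabanUV.Beta.MultiscaleGlobalOfLocal
import Summits.QuantumFields.BalabanUV.Beta.MultiscaleGradientMemberClosed
import Summits.QuantumFields.BalabanUV.Beta.MultiscaleLaplacianMember

/-!
# `Summit.QuantumFields.BalabanUV.Beta.MultiscaleGlobalGradientMember` — engine file 21b: the GLOBAL members (3.47)₂ and (3.47)₄ for
# the MODEL operator `levelOp` — `|∇G′u|_{(1+γ)} ≲ |u|_{(γ)}` (FLAT transport: d = 4 with NO binder from file 19c; general d MODULO the
# flat Poisson gradient binder (FG) from file 19b) and `|Δ_UG′u|_{(γ)} ≲ |u|_{(γ)}` (EVERY isometric transport, from file 10b) — each ONE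
# application of file 21a's abstract local ⟹ global theorem

HONEST FRAMING (page 1 of everything in this cell).  Discharging `FlowStep.BetaPertH` would make Bałaban's ultraviolet
stability UNCONDITIONAL — a constructive-QFT result; it is NOT the continuum limit and NOT the Clay problem.  This module
discharges nothing of `BetaPertH`; it is [folklore] finite-dimensional bookkeeping about the MODEL operator, kernel-checked, by the
OWNER of binder row D4 (unit `b2b-balaban-beta-an4`, gen 47).  HONEST DEPENDENCY: continuum YM on T⁴ ⇐ BetaPertH ∧ nine spine
estimates (0/9 proved); BetaPertH ⇐ (D1) ∧ (D4) ∧ CAP+tail; G-an2-4 gates asym, D1 and NE2/3/4.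

THE POINT (O.2 items (i)∕(ii), MODEL level; NOT the critical path).  [B9] (3.47) p. 398 (render `g46/renders/b9-p010-s4.png`, read as
image): «|G′(U)λ|_{(2+γ)}, |∇_UG′(U)λ|_{(1+γ)}, |G′(U)∇*_Uλ|_{(1+γ)}, |Δ_UG′(U)λ|_{(γ)} ≤ B₀|λ|_{(γ)} for γ in a fixed compact subset»
in the scale-weighted sup norms (3.41) `|λ|_{(γ)} = sup_j sup_{x ∈ Λ_j}(L^jη)^{−γ}|λ(x)|` (fourth member: print slip, G-B9-01).  In MODEL
currency: `|u(q)| ≤ n(q)^γ·U ⟹ |(G u)(ξ)| ≤ B·n(ξ)^{α+γ}·U`.  File 18 certified the first member (α = 2).  THIS FILE certifies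
* **(3.47)₂, α = 1, FLAT transport, d = 4, NO BINDER** — `real_global_grad_levelOp_inverse_le_d4`: file 19c's pointwise gradient member
  `real_grad_levelOp_inverse_le_d4` fed to 21a's `real_global_of_local_grading_pt` with `G = D ∘ (levelOp)⁻¹`, `pos = b₋`;
* **(3.47)₂, α = 1, FLAT transport, general d, MODULO (FG)** — `real_global_grad_levelOp_inverse_le_of_flatGradient`: the same from
  file 19b (the binder (FG) with free `K₁, K₂ ≥ 0` stays a hypothesis; d4-p2's `flatGradient_binder_d4` discharges it in d = 4);
* **(3.47)₄, α = 0, EVERY isometric transport, NO BINDER** — `real_global_lap_levelOp_inverse_le`: file 10b's covariant-Laplacian member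
  `real_lap_levelOp_inverse_le_graded` (cell-centre decay, no regularity datum) fed to 21a's `real_global_of_local_grading` with
  `G = D*D ∘ (levelOp)⁻¹`.
(3.47)₃ (`G′∇*`, α = 1) waits for its LOCAL member (3.42)₃, OPEN at MODEL level («GREEN-DECAY», census E-an4-141d (4)).  WHAT THIS IS
NOT: nothing of Bałaban's ∇_UG′(U)∕Δ_UG′(U) is instantiated; (3.47)₂ here is FLAT transport only (for rough transports the pointwise
gradient member fails level-free, E-an4-141d (3); print's device is (3.35) + [B4] Lemma 2.2); row D4 readiness width 0; D4 DISCHARGE NO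
DATE.

WHAT IS CERTIFIED (kernel, 0 sorry, 0 def): the three theorems above.  LOCATORS (shape only; ABSOLUTE RULE — nothing printed is
asserted): [Balaban1985BackgroundPropagators] (3.41) + Thm 3.1 (3.42), (3.47) pp. 397–398; [Balaban1984PropagatorsII] Lemma 2.1 (2.61)
p. 234; [Balaban1983RegularityDecay] Lemma 2.2 (2.17) pp. 577–578.  NOT BetaPertH, NOT continuum, NOT Clay, NOT summit progress.
-/

open scoped BigOperators
open Finset

namespace Summit.QuantumFields.BalabanUV.Beta.MultiscaleGlobalGradientMember

open Summit.QuantumFields.BalabanUV.Beta.MultiscaleGlobalOfLocal (real_global_of_local_grading real_global_of_local_grading_pt)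
open Summit.QuantumFields.BalabanUV.Beta.MultiscaleGradientMemberClosed (real_grad_levelOp_inverse_le_d4)
open Summit.QuantumFields.BalabanUV.Beta.MultiscaleGradientMember (real_grad_levelOp_inverse_le_of_flatGradient)
open Summit.QuantumFields.BalabanUV.Beta.MultiscaleLaplacianMember (real_lap_levelOp_inverse_le_graded)
open Summit.QuantumFields.BalabanUV.Beta.BoxPoincare (Box)
open Summit.QuantumFields.BalabanUV.Beta.MultiscaleCoerciveTorus
open Summit.QuantumFields.BalabanUV.Beta.MultiscaleDistance
open Summit.QuantumFields.BalabanUV.Beta.MultiscaleDecayBudget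
open Summit.QuantumFields.BalabanUV.Beta.HarmonicGradientInterior (Kgrad)
open Summit.QuantumFields.BalabanUV.Beta.TorusInversePowerSums (Cps Cps_nonneg)
open Summit.QuantumFields.BalabanUV.Beta.GreenGradientRowSum (Cdip Cdip_nonneg Kgrad_nonneg)
open Summit.QuantumFields.BalabanUV.Beta.SubsolutionMeanValueBox (Cmv)
open Literature.MathematicalPhysics.QuantumFieldTheory.Balaban1983to89
open Literature.MathematicalPhysics.QuantumFieldTheory.Balaban1983to89.B9Thm37Glue (covD covDT)
open Literature.MathematicalPhysics.QuantumFieldTheory.Balaban1983to89.B9Thm37GluePU (bsrc btgt)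
open Literature.MathematicalPhysics.QuantumFieldTheory.Balaban1983to89.B9Thm37GlueTorusCov (tblk)
open Literature.MathematicalPhysics.QuantumFieldTheory.Balaban1983to89.B9Thm37GlueTorusCovLevels (levelOp)
open B5TorusCover (UT Ctr ctrU)
open B5Leibniz121 (up dn)

noncomputable section

variable {d : ℕ} {N : Fin d → ℕ} [∀ i, NeZero (N i)] [NeZero d] {Cp J K : Type} [Fintype Cp] [DecidableEq Cp] [Nonempty Cp]
  [Fintype J] [Fintype K] [DecidableEq K] (S : J → ℕ) (hS : ∀ l, 1 ≤ S l) (hdivS : ∀ l i, S l ∣ N i) (lvl : K → J)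
  (zc : (k : K) → Ctr N (S (lvl k)))
  (hdisj : ∀ k k' v v', cellPt S hS hdivS lvl zc k v = cellPt S hS hdivS lvl zc k' v' → k = k')
  (hcover : ∀ x : UT N, ∃ k, ∃ v : Box d (S (lvl k)), cellPt S hS hdivS lvl zc k v = x)
  (Rm : UT N × Fin d → Cp → Cp → ℝ) (hRm : ∀ b i j, ∑ k, Rm b k i * Rm b k j = if i = j then (1 : ℝ) else 0)
  (T : J → UT N → Cp → Cp → ℝ) (hT : ∀ l x i i', ∑ k, T l x k i * T l x k i' = if i = i' then (1 : ℝ) else 0)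
  (a : J → ℝ) (ha : ∀ j, 0 ≤ a j) (ω : J → UT N → ℝ)
  (hsupp : ∀ l x, ω l (ctrU N (S l) (tblk (hS l) (hdivS l) x)) ≠ 0 → ∃ k v, lvl k = l ∧ cellPt S hS hdivS lvl zc k v = x)
  {amax : ℝ} (hamax : 0 ≤ amax)
  (hscale : ∀ k, a (lvl k) * ω (lvl k) (ctrU N (S (lvl k)) (zc k)) ^ 2 * (S (lvl k) : ℝ) ^ d ≤ amax / (S (lvl k) : ℝ) ^ 2)
  (c : UT N × Fin d → ℝ) {cmax : ℝ} (hc : ∀ b, |c b| ≤ cmax) {C : ℝ}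
  (hcoer : ∀ f : UT N × Cp → ℝ,
    C * ∑ k, ((S (lvl k) : ℝ) ^ 2)⁻¹ * ∑ v : Box d (S (lvl k)), ∑ i, f (cellPt S hS hdivS lvl zc k v, i) ^ 2 ≤
      ∑ p, f p * levelOp bsrc btgt c Rm (fun l x => ctrU N (S l) (tblk (hS l) (hdivS l) x))
        (fun l x => ω l (ctrU N (S l) (tblk (hS l) (hdivS l) x))) T a f p)
  {κ : ℝ} (hκ0 : 0 ≤ κ) (hκ1 : κ ≤ 1) (hμ : 0 < C - 2 * d * cmax ^ 2 * κ ^ 2 - amax * (Real.exp (2 * d * κ) - 1))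
  {L : ℕ} (hL : 1 ≤ L) (e : J → ℕ) (hSe : ∀ l, S l = L ^ e l) {R : ℝ} (hR : 0 < R) {A : ℕ}
  (hadd : ∀ x y : UT N, |(e (lvl (cellOf S hS hdivS lvl zc hcover x)) : ℝ) - e (lvl (cellOf S hS hdivS lvl zc hcover y))| ≤
    A + sdist bsrc btgt (siteScale S hS hdivS lvl zc hcover) x y / R)

include hdisj hRm hT ha hsupp hamax hscale hc hcoer hκ0 hκ1 hμ hL e hSe hR hadd

/-! ## §1 (3.47)₂ — the GLOBAL GRADIENT member, FLAT transport -/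

section Gradient

variable {c₀ : ℝ} (hcc : ∀ b, c b = c₀) (hc₀ : c₀ ≠ 0)

include hcc hc₀

/-- **THE GLOBAL GRADIENT MEMBER (3.47)₂'s SHAPE FOR `levelOp`, FLAT TRANSPORT, d = 4 — NO BINDER.**  MODEL setting of
`MultiscaleDecay.hc_levelOp` with a constant bond weight `c ≡ c₀`, flat transport `Rm ≡ 1`, the additive grading, the (P) budget, the rate
condition, on a torus `N : Fin 4 → ℕ` (`hd : d = 4`); letters `Γ, θ, δ, 𝔅` of files 19b∕19c; a real `γ` with `δ − |γ|·log L/R ≥ 0`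
and `ε > 0` with `e^{ε + 2(log L/R)d}·e^{−(δ − |γ|log L/R)} < 1`.  Then for EVERY `u` with `|u(q)| ≤ n(q)^γ·U` (`U ≥ 0`) and every
bond-component `(b,i)`:
`|(D(levelOp)⁻¹u)(b,i)| ≤ B_∇·e^{2dδ}·(L^A)^{|γ|}·(N₀Λ/(1 − Λe^{−(δ − |γ|log L/R)}))·n(b₋)·n(b₋)^γ·U` — `|∇G′u|_{(1+γ)} ≲ |u|_{(γ)}` —
with `B_∇` the constant of file 19c and `N₀, Λ` of beta-d4-p3's `cell_growth_add`: file 19c ∘ file 21a (`G = D ∘ (levelOp)⁻¹`,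
`pos = b₋`, α = 1). [cite: Balaban1985BackgroundPropagators, (3.47) p.398 + Thm 3.1 (3.42) p.397; Balaban1984PropagatorsII, Lemma 2.1 (2.61) p.234] [folklore] -/
theorem real_global_grad_levelOp_inverse_le_d4 (hd : d = 4) (hflat : ∀ b k i, Rm b k i = if k = i then 1 else 0)
    (hrate : (1 + d / 2) * (Real.log L / R) ≤ κ)
    {Γ θ δ 𝔅 : ℝ} (hΓ : Γ = (L : ℝ) ^ A * Real.exp (Real.log L / R * (4 * d + 1))) (hθ : θ = 1 / (4 * d * Γ))
    (hδ : δ = κ - (1 + d / 2) * (Real.log L / R))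
    (h𝔅 : 𝔅 = (max (Real.sqrt (11 ^ d)) (Cmv d * Real.sqrt (21 ^ d)) / Real.sqrt (θ ^ d) +
            Real.sqrt (Fintype.card Cp) * (θ + 1) ^ 2 * (amax * Γ ^ 2 * Real.sqrt (Γ ^ d)) / (2 * c₀ ^ 2)) *
          (Real.sqrt (Fintype.card Cp) * Real.exp (κ * ((4 * d + 1) + 2 * d)) *
            ((L : ℝ) ^ A * Real.exp (Real.log L / R * (4 * d + 1))) * (L : ℝ) ^ A * Real.sqrt (((L : ℝ) ^ A) ^ d) /
            (C - 2 * d * cmax ^ 2 * κ ^ 2 - amax * (Real.exp (2 * d * κ) - 1))) +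
          Real.sqrt (Fintype.card Cp) * (θ + 1) ^ 2 / (2 * c₀ ^ 2) *
            Real.exp ((κ - (1 + d / 2) * (Real.log L / R)) * ((4 * d + 1) + 2 * d)))
    {γ : ℝ} (hγ : 0 ≤ δ - |γ| * (Real.log L / R)) {ε : ℝ} (hε : 0 < ε)
    (hq : Real.exp (ε + 2 * (Real.log L / R) * d) * Real.exp (-(δ - |γ| * (Real.log L / R))) < 1)
    (u : UT N × Cp → ℝ) {U : ℝ} (hU : 0 ≤ U) (hu : ∀ q, |u q| ≤ (siteScale S hS hdivS lvl zc hcover q.1 : ℝ) ^ γ * U)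
    (b : UT N × Fin d) (i : Cp) :
    |covD bsrc btgt c Rm ((Ring.inverse (levelOp bsrc btgt c Rm (fun l x => ctrU N (S l) (tblk (hS l) (hdivS l) x))
        (fun l x => ω l (ctrU N (S l) (tblk (hS l) (hdivS l) x))) T a)) u) (b, i)| ≤
      |c₀| * (𝔅 * (Γ ^ 2 * Real.exp δ + 1) * (16 * d * Γ) + Kgrad d * 𝔅 * Γ ^ 2 * Real.exp δ * (16 * d * Γ) +
          (9 / 2 * Kgrad d + 36 * Cdip d * Cps d) * (θ / 4 + 1) *
            (Real.exp (δ * (2 * d + 1)) + amax * Real.sqrt (Fintype.card Cp) * 𝔅 * Real.exp (δ * (4 * d + 1))) / c₀ ^ 2) *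
        Real.exp (2 * d * δ) * ((L : ℝ) ^ A) ^ |γ| *
        ((3 * ((L : ℝ) ^ A) ^ 2) ^ d * ((d.factorial : ℝ) / ε ^ d) * Real.exp (2 * d * (ε + Real.log L / R * d)) *
            Real.exp (ε + 2 * (Real.log L / R) * d) /
          (1 - Real.exp (ε + 2 * (Real.log L / R) * d) * Real.exp (-(δ - |γ| * (Real.log L / R))))) *
        (siteScale S hS hdivS lvl zc hcover (bsrc b) : ℝ) * (siteScale S hS hdivS lvl zc hcover (bsrc b) : ℝ) ^ γ * U := by
  -- the local member of file 19c, BEFORE any abbreviation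
  have h19c := real_grad_levelOp_inverse_le_d4 S hS hdivS lvl zc hdisj hcover Rm hRm T hT a ha ω hsupp hamax hscale c hcc hc₀ hL e
    hSe hR hadd hd hflat hc hcoer hκ0 hκ1 hμ hrate hΓ hθ hδ h𝔅
  -- positivity of the letters
  set μ₀ := C - 2 * d * cmax ^ 2 * κ ^ 2 - amax * (Real.exp (2 * d * κ) - 1) with hμ₀
  have hd1 : 1 ≤ d := Nat.one_le_iff_ne_zero.mpr (NeZero.ne d)
  have hL1 : (1 : ℝ) ≤ L := by exact_mod_cast hL
  have hd0 : (0 : ℝ) < d := by exact_mod_cast Nat.pos_of_ne_zero (NeZero.ne d)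
  have ht0 : 0 ≤ Real.log L / R := div_nonneg (Real.log_nonneg hL1) hR.le
  have hΓ0 : 0 < Γ := by rw [hΓ]; positivity
  have hθ0 : 0 < θ := by rw [hθ]; positivity
  have hδ0 : 0 ≤ δ := by rw [hδ]; linarith
  have hc2 : (0 : ℝ) < c₀ ^ 2 := by positivity
  have h𝔅0 : 0 ≤ 𝔅 := by rw [h𝔅]; positivity
  have hK1 : 0 ≤ Kgrad d := Kgrad_nonneg hd1
  have hK2 : 0 ≤ Cdip d := Cdip_nonneg hd1
  have hK3 : 0 ≤ Cps d := Cps_nonneg d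
  have hB : 0 ≤ |c₀| * (𝔅 * (Γ ^ 2 * Real.exp δ + 1) * (16 * d * Γ) + Kgrad d * 𝔅 * Γ ^ 2 * Real.exp δ * (16 * d * Γ) +
      (9 / 2 * Kgrad d + 36 * Cdip d * Cps d) * (θ / 4 + 1) *
        (Real.exp (δ * (2 * d + 1)) + amax * Real.sqrt (Fintype.card Cp) * 𝔅 * Real.exp (δ * (4 * d + 1))) / c₀ ^ 2) := by
    positivity
  -- the linear map `G = D ∘ (levelOp)⁻¹`, sited by `b₋` on the target and by the site on the source
  set Aop := levelOp bsrc btgt c Rm (fun l x => ctrU N (S l) (tblk (hS l) (hdivS l) x))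
    (fun l x => ω l (ctrU N (S l) (tblk (hS l) (hdivS l) x))) T a with hAop
  set G : (UT N × Cp → ℝ) →ₗ[ℝ] ((UT N × Fin d) × Cp → ℝ) := covD bsrc btgt c Rm ∘ₗ Ring.inverse Aop with hG
  have hGap : ∀ v ξ, G v ξ = covD bsrc btgt c Rm ((Ring.inverse Aop) v) ξ := fun v ξ => rfl
  have h := real_global_of_local_grading_pt S hS hdivS lvl zc hdisj hcover G Prod.fst (fun ξ => bsrc ξ.1) 1 hB hδ0
    (fun k' v hv m hm hvm ξ => by
      rw [hGap, pow_one]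
      exact h19c k' v hv hm hvm ξ.1 ξ.2)
    hL e hSe hR hadd hγ hε hq u hU hu (b, i)
  rw [hGap, pow_one] at h
  simpa only [mul_assoc] using h

/-- **THE GLOBAL GRADIENT MEMBER (3.47)₂'s SHAPE FOR `levelOp`, FLAT TRANSPORT, general `d`, MODULO THE FLAT POISSON GRADIENT BINDER
(FG)** (file 19b's hypothesis with free `K₁, K₂ ≥ 0`; in d = 4 it is d4-p2's theorem `flatGradient_binder_d4`): file 19b ∘ file 21a.
[cite: Balaban1985BackgroundPropagators, (3.47) p.398 + Thm 3.1 (3.42) p.397; Balaban1983RegularityDecay, Lemma 2.2 (2.17) p.578] [folklore] -/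
theorem real_global_grad_levelOp_inverse_le_of_flatGradient (hflat : ∀ b k i, Rm b k i = if k = i then 1 else 0)
    (hrate : (1 + d / 2) * (Real.log L / R) ≤ κ)
    {Γ θ δ 𝔅 : ℝ} (hΓ : Γ = (L : ℝ) ^ A * Real.exp (Real.log L / R * (4 * d + 1))) (hθ : θ = 1 / (4 * d * Γ))
    (hδ : δ = κ - (1 + d / 2) * (Real.log L / R))
    (h𝔅 : 𝔅 = (max (Real.sqrt (11 ^ d)) (Cmv d * Real.sqrt (21 ^ d)) / Real.sqrt (θ ^ d) +
            Real.sqrt (Fintype.card Cp) * (θ + 1) ^ 2 * (amax * Γ ^ 2 * Real.sqrt (Γ ^ d)) / (2 * c₀ ^ 2)) *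
          (Real.sqrt (Fintype.card Cp) * Real.exp (κ * ((4 * d + 1) + 2 * d)) *
            ((L : ℝ) ^ A * Real.exp (Real.log L / R * (4 * d + 1))) * (L : ℝ) ^ A * Real.sqrt (((L : ℝ) ^ A) ^ d) /
            (C - 2 * d * cmax ^ 2 * κ ^ 2 - amax * (Real.exp (2 * d * κ) - 1))) +
          Real.sqrt (Fintype.card Cp) * (θ + 1) ^ 2 / (2 * c₀ ^ 2) *
            Real.exp ((κ - (1 + d / 2) * (Real.log L / R)) * ((4 * d + 1) + 2 * d)))
    {K₁ K₂ : ℝ} (hK₁ : 0 ≤ K₁) (hK₂ : 0 ≤ K₂)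
    (hFG : ∀ (x₀ : UT N) (R : ℕ), 1 ≤ R → (∀ i, 10 * R + 4 ≤ N i) → ∀ (w : UT N → ℝ) (M G : ℝ),
      (∀ x ∈ univ.filter (fun x : UT N => dist x x₀ ≤ 2 * R + 2), |w x| ≤ M) →
      (∀ x ∈ univ.filter (fun x : UT N => dist x x₀ ≤ 2 * R + 2),
        |((∑ b ∈ univ.filter (fun b : UT N × Fin d => btgt b = x), c b ^ 2) +
              ∑ b ∈ univ.filter (fun b : UT N × Fin d => bsrc b = x), c b ^ 2) * w x -
            ((∑ b ∈ univ.filter (fun b : UT N × Fin d => btgt b = x), c b ^ 2 * w (bsrc b)) +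
              ∑ b ∈ univ.filter (fun b : UT N × Fin d => bsrc b = x), c b ^ 2 * w (btgt b))| ≤ G) →
      ∀ μ, |w (up x₀ μ) - w x₀| ≤ K₁ * M / ((R : ℝ) + 1) + K₂ * ((R : ℝ) + 1) * G / c₀ ^ 2)
    {γ : ℝ} (hγ : 0 ≤ δ - |γ| * (Real.log L / R)) {ε : ℝ} (hε : 0 < ε)
    (hq : Real.exp (ε + 2 * (Real.log L / R) * d) * Real.exp (-(δ - |γ| * (Real.log L / R))) < 1)
    (u : UT N × Cp → ℝ) {U : ℝ} (hU : 0 ≤ U) (hu : ∀ q, |u q| ≤ (siteScale S hS hdivS lvl zc hcover q.1 : ℝ) ^ γ * U)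
    (b : UT N × Fin d) (i : Cp) :
    |covD bsrc btgt c Rm ((Ring.inverse (levelOp bsrc btgt c Rm (fun l x => ctrU N (S l) (tblk (hS l) (hdivS l) x))
        (fun l x => ω l (ctrU N (S l) (tblk (hS l) (hdivS l) x))) T a)) u) (b, i)| ≤
      |c₀| * (𝔅 * (Γ ^ 2 * Real.exp δ + 1) * (16 * d * Γ) + K₁ * 𝔅 * Γ ^ 2 * Real.exp δ * (16 * d * Γ) +
          K₂ * (θ / 4 + 1) * (Real.exp (δ * (2 * d + 1)) + amax * Real.sqrt (Fintype.card Cp) * 𝔅 * Real.exp (δ * (4 * d + 1))) /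
            c₀ ^ 2) *
        Real.exp (2 * d * δ) * ((L : ℝ) ^ A) ^ |γ| *
        ((3 * ((L : ℝ) ^ A) ^ 2) ^ d * ((d.factorial : ℝ) / ε ^ d) * Real.exp (2 * d * (ε + Real.log L / R * d)) *
            Real.exp (ε + 2 * (Real.log L / R) * d) /
          (1 - Real.exp (ε + 2 * (Real.log L / R) * d) * Real.exp (-(δ - |γ| * (Real.log L / R))))) *
        (siteScale S hS hdivS lvl zc hcover (bsrc b) : ℝ) * (siteScale S hS hdivS lvl zc hcover (bsrc b) : ℝ) ^ γ * U := by
  -- the local member of file 19b, BEFORE any abbreviation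
  have h19b := real_grad_levelOp_inverse_le_of_flatGradient S hS hdivS lvl zc hdisj hcover Rm hRm T hT a ha ω hsupp hamax hscale c
    hcc hc₀ hL e hSe hR hadd hflat hc hcoer hκ0 hκ1 hμ hrate hΓ hθ hδ h𝔅 hK₁ hK₂ hFG
  -- positivity of the letters
  set μ₀ := C - 2 * d * cmax ^ 2 * κ ^ 2 - amax * (Real.exp (2 * d * κ) - 1) with hμ₀
  have hL1 : (1 : ℝ) ≤ L := by exact_mod_cast hL
  have hd0 : (0 : ℝ) < d := by exact_mod_cast Nat.pos_of_ne_zero (NeZero.ne d)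
  have ht0 : 0 ≤ Real.log L / R := div_nonneg (Real.log_nonneg hL1) hR.le
  have hΓ0 : 0 < Γ := by rw [hΓ]; positivity
  have hθ0 : 0 < θ := by rw [hθ]; positivity
  have hδ0 : 0 ≤ δ := by rw [hδ]; linarith
  have hc2 : (0 : ℝ) < c₀ ^ 2 := by positivity
  have h𝔅0 : 0 ≤ 𝔅 := by rw [h𝔅]; positivity
  have hB : 0 ≤ |c₀| * (𝔅 * (Γ ^ 2 * Real.exp δ + 1) * (16 * d * Γ) + K₁ * 𝔅 * Γ ^ 2 * Real.exp δ * (16 * d * Γ) +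
      K₂ * (θ / 4 + 1) * (Real.exp (δ * (2 * d + 1)) + amax * Real.sqrt (Fintype.card Cp) * 𝔅 * Real.exp (δ * (4 * d + 1))) /
        c₀ ^ 2) := by
    positivity
  set Aop := levelOp bsrc btgt c Rm (fun l x => ctrU N (S l) (tblk (hS l) (hdivS l) x))
    (fun l x => ω l (ctrU N (S l) (tblk (hS l) (hdivS l) x))) T a with hAop
  set G : (UT N × Cp → ℝ) →ₗ[ℝ] ((UT N × Fin d) × Cp → ℝ) := covD bsrc btgt c Rm ∘ₗ Ring.inverse Aop with hG
  have hGap : ∀ v ξ, G v ξ = covD bsrc btgt c Rm ((Ring.inverse Aop) v) ξ := fun v ξ => rfl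
  have h := real_global_of_local_grading_pt S hS hdivS lvl zc hdisj hcover G Prod.fst (fun ξ => bsrc ξ.1) 1 hB hδ0
    (fun k' v hv m hm hvm ξ => by
      rw [hGap, pow_one]
      exact h19b k' v hv hm hvm ξ.1 ξ.2)
    hL e hSe hR hadd hγ hε hq u hU hu (b, i)
  rw [hGap, pow_one] at h
  simpa only [mul_assoc] using h

end Gradient

/-! ## §2 (3.47)₄ — the GLOBAL LAPLACIAN member, EVERY isometric transport -/

/-- **THE GLOBAL COVARIANT-LAPLACIAN MEMBER (3.47)₄'s SHAPE FOR `levelOp` — EVERY ISOMETRIC TRANSPORT, NO BINDER.**  MODEL setting of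
`MultiscaleDecay.hc_levelOp` (isometric `Rm`, `T`; (P) budget; `|c| ≤ c_max`; margin `μ₀ > 0`), the additive grading; a real `γ` with
`δ_γ := κ − (1 + d/2)·log L/R − |γ|·log L/R ≥ 0` and `ε > 0` with `e^{ε + 2(log L/R)d}·e^{−δ_γ} < 1`.  Then for EVERY `u` with
`|u(q)| ≤ n(q)^γ·U` (`U ≥ 0`) and every `p = (x,i)`:
`|((D*D)(levelOp)⁻¹u)(p)| ≤ (1 + a_max·√|Cp|·L^A·√((L^A)^d)·e^{4dκ}/μ₀)·(L^A)^{|γ|}·(N₀Λ/(1 − Λe^{−δ_γ}))·n(x)^γ·U` —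
`|Δ_UG′u|_{(γ)} ≲ |u|_{(γ)}` with NO power of the local scale: file 10b's `real_lap_levelOp_inverse_le_graded` (cell-centre decay, no
regularity datum) ∘ file 21a's `real_global_of_local_grading` (`G = D*D ∘ (levelOp)⁻¹`, α = 0).
[cite: Balaban1985BackgroundPropagators, (3.47) p.398 + Thm 3.1 (3.42) p.397 + (3.24) p.394; Balaban1984PropagatorsII, Lemma 2.1 (2.61) p.234] [folklore] -/
theorem real_global_lap_levelOp_inverse_le
    {γ : ℝ} (hγ : 0 ≤ κ - (1 + d / 2) * (Real.log L / R) - |γ| * (Real.log L / R)) {ε : ℝ} (hε : 0 < ε)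
    (hq : Real.exp (ε + 2 * (Real.log L / R) * d) *
      Real.exp (-(κ - (1 + d / 2) * (Real.log L / R) - |γ| * (Real.log L / R))) < 1)
    (u : UT N × Cp → ℝ) {U : ℝ} (hU : 0 ≤ U) (hu : ∀ q, |u q| ≤ (siteScale S hS hdivS lvl zc hcover q.1 : ℝ) ^ γ * U)
    (p : UT N × Cp) :
    |covDT bsrc btgt c Rm (covD bsrc btgt c Rm
        ((Ring.inverse (levelOp bsrc btgt c Rm (fun l x => ctrU N (S l) (tblk (hS l) (hdivS l) x))
          (fun l x => ω l (ctrU N (S l) (tblk (hS l) (hdivS l) x))) T a)) u)) p| ≤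
      (1 + amax * Real.sqrt (Fintype.card Cp) * (L : ℝ) ^ A * Real.sqrt (((L : ℝ) ^ A) ^ d) * Real.exp (4 * d * κ) /
          (C - 2 * d * cmax ^ 2 * κ ^ 2 - amax * (Real.exp (2 * d * κ) - 1))) *
        ((L : ℝ) ^ A) ^ |γ| *
        ((3 * ((L : ℝ) ^ A) ^ 2) ^ d * ((d.factorial : ℝ) / ε ^ d) * Real.exp (2 * d * (ε + Real.log L / R * d)) *
            Real.exp (ε + 2 * (Real.log L / R) * d) /
          (1 - Real.exp (ε + 2 * (Real.log L / R) * d) *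
            Real.exp (-(κ - (1 + d / 2) * (Real.log L / R) - |γ| * (Real.log L / R))))) *
        (siteScale S hS hdivS lvl zc hcover p.1 : ℝ) ^ γ * U := by
  -- the local member of file 10b, BEFORE any abbreviation
  have h10b := real_lap_levelOp_inverse_le_graded S hS hdivS lvl zc hdisj hcover Rm hRm T hT a ha ω hsupp hamax hscale c hc hcoer
    hκ0 hκ1 hμ hL e hSe hR (A := A)
  set μ₀ := C - 2 * d * cmax ^ 2 * κ ^ 2 - amax * (Real.exp (2 * d * κ) - 1) with hμ₀
  have hL1 : (1 : ℝ) ≤ L := by exact_mod_cast hL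
  have hB : 0 ≤ 1 + amax * Real.sqrt (Fintype.card Cp) * (L : ℝ) ^ A * Real.sqrt (((L : ℝ) ^ A) ^ d) * Real.exp (4 * d * κ) / μ₀ := by
    positivity
  -- the cell of a centre is its cell
  have hkc : ∀ k', cellOf S hS hdivS lvl zc hcover (ctrU N (S (lvl k')) (zc k')) = k' := fun k' => by
    rw [← cubePt_zero (hS (lvl k')) (hdivS (lvl k')) (zc k')]
    exact cellOf_cellPt S hS hdivS lvl zc hdisj hcover k' _
  -- the additive datum at a pair of centres
  have haddc : ∀ k k' : K, |(e (lvl k) : ℝ) - e (lvl k')| ≤ A + sdist bsrc btgt (siteScale S hS hdivS lvl zc hcover)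
      (ctrU N (S (lvl k)) (zc k)) (ctrU N (S (lvl k')) (zc k')) / R := by
    intro k k'
    have h := hadd (ctrU N (S (lvl k)) (zc k)) (ctrU N (S (lvl k')) (zc k'))
    rwa [hkc, hkc] at h
  set Aop := levelOp bsrc btgt c Rm (fun l x => ctrU N (S l) (tblk (hS l) (hdivS l) x))
    (fun l x => ω l (ctrU N (S l) (tblk (hS l) (hdivS l) x))) T a with hAop
  set G : (UT N × Cp → ℝ) →ₗ[ℝ] (UT N × Cp → ℝ) := (covDT bsrc btgt c Rm ∘ₗ covD bsrc btgt c Rm) ∘ₗ Ring.inverse Aop with hG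
  have hGap : ∀ v ξ, G v ξ = covDT bsrc btgt c Rm (covD bsrc btgt c Rm ((Ring.inverse Aop) v)) ξ := fun v ξ => rfl
  have h := real_global_of_local_grading S hS hdivS lvl zc hdisj hcover G Prod.fst Prod.fst 0 hB
    (fun k' v hv m hm hvm ξ => by
      rw [hGap, pow_zero, mul_one]
      exact h10b (cellOf S hS hdivS lvl zc hcover ξ.1) k' (haddc _ _) v hv hm hvm ξ rfl)
    hL e hSe hR hadd hγ hε hq u hU hu p
  rw [hGap, pow_zero, mul_one] at h
  simpa only [mul_assoc] using h

end

end Summit.QuantumFields.BalabanUV.Beta.MultiscaleGlobalGradientMember
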